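import Literature.AnabelianGeometry.EtaleTheta.Discharge.Sec2Cor28iArbitraryAutOfSection
import Literature.AnabelianGeometry.EtaleTheta.Discharge.Sec2ThetaOrbitTransportCalculusOfEmbedding
import Literature.AnabelianGeometry.EtaleTheta.Discharge.Sec2CuspStabSectionDatum
import HarnessLib

/-!
# [EtTh] Cor 2.8 (i) in HEAD FORM at its natural carrier `ThetaOrbitData.ofEmbedding`: the typed row
# `ThetaOrbitData.Cor28_i` ITSELF, modulo ONE displayed hypothesis (proof-only knit; FACT-LIST row F-0640)

S. Mochizuki, *The étale theta function and its Frobenioid-theoretic manifestations* [EtTh], Publ. RIMS **45**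
(2009), §2, Cor 2.8 (i) PRIMS PDF p.42 («Suppose that γ … induces an automorphism of Δ_Θ … Then γ preserves the
property that η̲̈^{Θ,l·ℤ×μ₂} (resp. η̈^{Θ,ℤ×μ₂}; η̲̈^{Θ,l·ℤ×μ₂}; η̈^{Θ,l·ℤ×μ₂}) be of standard type — a property that
determines this collection of classes up to multiplication by a root of unity of order l (resp. 1; l; 1)»; proof:
«follows immediately from Theorem 1.10, (i), and the definitions»), Prop 2.4 p.38, Def 2.7 p.41, Thm 1.6 (ii)/(iii)
p.24, Thm 1.10 (i) p.30 (bib key `MochizukiEtTh2009`; locators = PRIMS PDF pages).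

PROOF-ONLY companion (0 `def`, 0 `instance`, 0 notation, no new `Prop`; cell abc-iut, block F, seat abc-iut-f-193
gen 16 — row «F0640-HEAD-INSTANCE», abc-iut-L2-lead R1498 (custody WELCOME, count-neutral); F-lane INST59 currency
for FACT-LIST row **F-0640** `ThetaCovers.ThetaOrbitData.Cor28_i`, whose kernel census read «refuters only»
(`not_forall_cor28_i`, `exists_model_counterexample`, `exists_orbitData_counterexample`) although the conclusion-level
content is in tree: abc-iut-w6-d049 / abc-iut-w6-d051 / abc-iut-f-151 / abc-iut-L2-t1 / abc-iut-f-161 prove the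
4-tuple C1–C4 (or single conjuncts) of `Cor28_i` at `ofEmbedding` per pair `(Γ, Γ_Θ)`, never the head `O.Cor28_i`.
Every input BY NAME.)

* §1 **`OrbitEmbedding.ofEmbedding_cor28_i_of_forall_comm`** — `(ThetaOrbitData.ofEmbedding ε hC hS).Cor28_i` IN HEAD
  FORM at abc-iut-L2-t2's constructor along ANY orbit embedding `ε`, modulo the carrier identification
  `ι(Π^tp_{X̲}) = T.tp T.PiXu` and ONE displayed hypothesis `H` = the ∀Γ-closure of the residual displayed by
  abc-iut-L2-t1's `ofEmbedding_cor28_i_of_comm_reduced` (`Sec2Cor28iArbitraryAut` §3): every topological automorphism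
  `Γ` of `Π^tp_C` inducing `Γ_Θ` on `Δ_Θ`, permuting `Dtau` and stabilising `Π^tp_Ÿ`, `Π^tp_X` admits a compatible
  pair `(α, β)` (`ι ∘ α = Γ ∘ ι`: Prop 2.4, `Γ` restricts to `Π^tp_X`; `β ∘ toTheta = toTheta ∘ α`: the Thm 1.6 (ii)
  companion) and `σ₀` with the UNIT-FREE theta-rigidity identity `autMap α⁻¹ β⁻¹ η̈^Θ = σ₀·η̈^Θ` (Thm 1.6 (iii) /
  Thm 1.10 (i) with unit `1`), `σ₀ ∈ Π^tp_{X̲̲}` (resp. `∈ Π^tp_{X̲}`) whenever `Γ` stabilises `Π^tp_{X̲̲}` (resp.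
  `Π^tp_{X̲}`).  Conjunct 1 («preserves the property … of standard type») uses NO part of `H`: it is
  abc-iut-w6-d051's generic `ThetaOrbitData.isStandardColl_transport_etaZMu2` (`Dtau` finite, `InducesOnTheta`
  intertwines the conjugation actions); conjuncts 2–4 are abc-iut-L2-t1's §2 transports (exactly, `κ = 1`).  The two
  tower stabilities `Γ(Π^tp_{X̲̲})`, `Γ(Π^tp_{X̲})` that `_reduced` carries as standing binders appear here as
  antecedents of the `σ₀`-location clauses, because `Cor28_i` owes its conjunct 3 under `[Π^tp_{X̲}, Π^tp_X,
  Π^tp_Ÿ]`-stability only.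
* §2 **`MuTwoSetting.CLevelData.cor28_i_orbitEmbeddingOfHuuOfSection_of_forall_restricts`** — the same head at the
  SECTION-route cover `ofEmbedding (orbitEmbeddingOfHuuOfSection …)` (abc-iut-L2-d3 / abc-iut-f-151; any
  `CLevelData`, completion, section, `g`, `X̲̲`, slots `τ, τ′`), with `ι(Π^tp_{X̲}) = T.tp T.PiXu` DISCHARGED
  (abc-iut-f-151's `orbitEmbeddingOfHuuOfSection_map_GtpXu`) and `H` in print's currency: `Γ` restricts to
  `α ∈ Aut_top(Π^tp_X)` with `α(Δ^tp_X) = Δ^tp_X` ([AbsAnab] Lem 1.3.8), the companion being abc-iut-L6-d5's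
  `Thm16Sub.topCompanion α` (Thm 1.6 (ii), granted `IsQuotientMap toTheta`), plus located unit-free rigidity.
Consumer of the head: abc-iut-w5-d118's `exists_rep_transport_eq_mul_coboundary_of_cor28_i`
(`Sec2OrbitEmbeddingAutTransport`, hypothesis `h28 : (ThetaOrbitData.ofEmbedding ε hC hS).Cor28_i`).  Sequel at THE cover of
record: this seat's `Cor28iHeadFormCoverOfRecord`.  DISTINCT route on the same row: abc-iut-f-128's monodromy-toy orbit datum
(abc-iut-L2-lead R1504; a designed-toy NEGATIVE `¬ Cor28_i` with its Def 2.5 (i)(a) diagnosis) — not this carrier, not cited here as input.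

HONEST FRAMING / WHAT IS NOT CLAIMED: this is a CONDITIONAL instance — `H` is DISPLAYED, not proved; it is the typed
content of Prop 2.4 + Thm 1.6 (ii) + Thm 1.10 (i) for ALL topological `Γ` permuting `D_{τ^{±1}}` at the typed carrier,
and its UNIT-FREE form is STRONGER than print's unit-carrying Thm 1.6 (iii) (abc-iut-L2-t1 `Sec2Cor28iArbitraryAut` §4:
with a genuine unit the transport is only a twist; at the cusped inversion model the class of `−1` is not absorbed,
abc-iut-f-151's `conj_etaDdχ_eq_self_of_mem_GtpY`); at THE cover of record over `inversionModelχ′` the truth of `H` is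
the question «AUT-CLASSIFICATION @ modelχ′» sized UNDECIDABLE-WITH-TREE by abc-iut-f-142 (abc-iut-L2-lead R1429, PARKED).
The ∀-closure of `Cor28_i` over the interface is refuted (abc-iut-w4-d051's `not_forall_cor28_i`).  [EtTh] is
refereed and nothing of it is asserted here; statements about the TYPED interface at semi-synthetic carriers only
(consistency / non-vacuity evidence); no side is taken on [IUTchIII] Cor 3.12; typed ≠ proved; instantiated ≠ endorsed.
-/

noncomputable section

namespace Literature.AnabelianGeometry.EtaleTheta

open Literature.AnabelianGeometry.SemiGraphs ThetaCovers Literature.IUT.HodgeArakelov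
open _root_.Topology
open ThetaSetting.EtaleThetaData.DoubleUnderline.OrbitEmbedding (symm_toTheta_eq)

universe u

namespace ThetaSetting.EtaleThetaData.DoubleUnderline.OrbitEmbedding

variable {p : ℕ} [Fact p.Prime] {D : ThetaSetting p} {E : D.EtaleThetaData} {l : ℕ}
  {C : E.DoubleUnderline l} {T : TemperedCoverData.{u} l} (ε : C.OrbitEmbedding T)

/-- **[EtTh] Cor 2.8 (i) — the typed row `ThetaOrbitData.Cor28_i` IN HEAD FORM at `ofEmbedding ε hC hS`**, modulo the
identification `ι(Π^tp_{X̲}) = T.tp T.PiXu` and ONE displayed hypothesis `H`: for every topological automorphism `Γ` of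
`Π^tp_C` with an induced `Γ_Θ` on `Δ_Θ` (`InducesOnTheta`), permuting `Dtau`, stabilising `Π^tp_Ÿ` and `Π^tp_X`, there are
a compatible pair `(α, β)` — `ι ∘ α = Γ ∘ ι` (Prop 2.4: `Γ` restricts to `Π^tp_X`), `β ∘ toTheta = toTheta ∘ α` (Thm 1.6 (ii):
the companion on `(Π^tp_X)^Θ`) — and `σ₀ ∈ Π^tp_X` with the UNIT-FREE theta-rigidity identity `autMap α⁻¹ β⁻¹ η̈^Θ = σ₀·η̈^Θ`
(Thm 1.6 (iii) / Thm 1.10 (i) with unit `1`), `σ₀` lying in `Π^tp_{X̲̲}` (resp. `Π^tp_{X̲}`) whenever `Γ` stabilises it.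
Conjunct 1 («`γ` preserves the property … of standard type») uses NO part of `H` (abc-iut-w6-d051's generic
`isStandardColl_transport_etaZMu2`, `Dtau` finite); conjuncts 2–4 are abc-iut-L2-t1's transports `ofEmbedding_transport_*_of_comm`
(exactly, `κ = 1`).  HONEST LABEL: CONDITIONAL INSTANCE; `H` is displayed, not proved.
[cite: MochizukiEtTh2009, Cor 2.8(i) p.42] -/
theorem ofEmbedding_cor28_i_of_forall_comm (hC : D.Compat) (hS : D.Sec2Hyps)
    (hXuι : (D.GtpXu l).map ε.ι = T.tp T.PiXu)
    (H : ∀ (Γ : T.Gtp ≃ₜ* T.Gtp)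
        (ΓΘ : (ThetaOrbitData.ofEmbedding ε hC hS).DeltaTheta ≃* (ThetaOrbitData.ofEmbedding ε hC hS).DeltaTheta),
        (ThetaOrbitData.ofEmbedding ε hC hS).InducesOnTheta Γ ΓΘ →
        (∀ Dt ∈ (ThetaOrbitData.ofEmbedding ε hC hS).Dtau,
          Dt.map Γ.toMulEquiv.toMonoidHom ∈ (ThetaOrbitData.ofEmbedding ε hC hS).Dtau) →
        T.PiYddtp.map Γ.toMulEquiv.toMonoidHom = T.PiYddtp →
        (T.tp T.PiX).map Γ.toMulEquiv.toMonoidHom = T.tp T.PiX →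
        ∃ (α : D.PiTemp ≃ₜ* D.PiTemp) (β : D.GtpTheta ≃ₜ* D.GtpTheta)
          (hβ : ∀ g, β (D.toTheta g) = D.toTheta (α g)),
          (∀ g, ε.ι (α g) = Γ (ε.ι g)) ∧
          ∃ σ₀ : D.PiTemp,
            ((T.tp T.PiXuu).map Γ.toMulEquiv.toMonoidHom = T.tp T.PiXuu → σ₀ ∈ C.Huu) ∧
            ((T.tp T.PiXu).map Γ.toMulEquiv.toMonoidHom = T.tp T.PiXu → σ₀ ∈ D.GtpXu l) ∧
            ∀ (hΔ' : ∀ a, a ∈ D.DeltaTheta → β.symm a ∈ D.DeltaTheta)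
              (hY : ∀ g, g ∈ D.GtpYdd → α g ∈ D.GtpYdd),
              haveI := hC.GtpYdd_normal
              ContH1Aut.autMap D.toTheta D.DeltaTheta α.symm β.symm (symm_toTheta_eq hβ) hΔ'
                  (H := D.GtpYdd) (H' := D.GtpYdd) hY E.etaDd =
                ContH1.conj D.toTheta D.DeltaTheta σ₀ E.etaDd) :
    (ThetaOrbitData.ofEmbedding ε hC hS).Cor28_i := by
  intro hstd Γ ΓΘ hind hDtau hYmap hYuu
  refine ⟨(ThetaOrbitData.ofEmbedding ε hC hS).isStandardColl_transport_etaZMu2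
      (ThetaOrbitData.ofEmbedding_Dtau_finite ε hC hS) hstd hind hDtau hYmap, ?_, ?_, ?_⟩
  · intro htower
    have hXuu : (T.tp T.PiXuu).map Γ.toMulEquiv.toMonoidHom = T.tp T.PiXuu :=
      htower _ (by simp [TemperedCoverData.tower])
    have hX : (T.tp T.PiX).map Γ.toMulEquiv.toMonoidHom = T.tp T.PiX :=
      htower _ (by simp [TemperedCoverData.tower])
    obtain ⟨α, β, hβ, hα, σ₀, hσU, -, hη⟩ := H Γ ΓΘ hind hDtau hYmap hX
    obtain ⟨hΔ, hΔ'⟩ := ε.stab_DeltaTheta_of_induces_comm hC hS hα hβ hind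
    obtain ⟨hY, hY'⟩ := ε.stab_GtpYdd_of_comm hα hYmap
    obtain ⟨hU, hU'⟩ := ε.stab_Huu_of_comm hα hXuu
    rw [ε.ofEmbedding_transport_rootLZMu2_of_comm hC hS hα hβ hΔ hΔ' hY hY' hU hU' ΓΘ hind hYuu (hσU hXuu)
      (hη hΔ' hY)]
    exact ThetaOrbitData.eqUpToRootOfUnity_refl _ _ _ _
  · intro h3
    have hX : (T.tp T.PiX).map Γ.toMulEquiv.toMonoidHom = T.tp T.PiX := h3 _ (by simp)
    obtain ⟨α, β, hβ, hα, σ₀, -, -, hη⟩ := H Γ ΓΘ hind hDtau hYmap hX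
    obtain ⟨hΔ, hΔ'⟩ := ε.stab_DeltaTheta_of_induces_comm hC hS hα hβ hind
    obtain ⟨hY, hY'⟩ := ε.stab_GtpYdd_of_comm hα hYmap
    rw [ε.ofEmbedding_transport_etaZMu2_of_comm hC hS hα hβ hΔ hΔ' hY hY' ΓΘ hind hYmap (hη hΔ' hY)]
    exact ThetaOrbitData.eqUpToRootOfUnity_refl _ _ _ _
  · intro h4
    have hXu : (T.tp T.PiXu).map Γ.toMulEquiv.toMonoidHom = T.tp T.PiXu := h4 _ (by simp)
    have hX : (T.tp T.PiX).map Γ.toMulEquiv.toMonoidHom = T.tp T.PiX := h4 _ (by simp)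
    obtain ⟨α, β, hβ, hα, σ₀, -, hσXu, hη⟩ := H Γ ΓΘ hind hDtau hYmap hX
    obtain ⟨hΔ, hΔ'⟩ := ε.stab_DeltaTheta_of_induces_comm hC hS hα hβ hind
    obtain ⟨hY, hY'⟩ := ε.stab_GtpYdd_of_comm hα hYmap
    obtain ⟨hXu₁, hXu₂⟩ := ε.stab_GtpXu_of_comm hXuι hα hXu
    rw [ε.ofEmbedding_transport_etaLZMu2_of_comm hC hS hα hβ hΔ hΔ' hY hY' hXu₁ hXu₂ ΓΘ hind hYmap (hσXu hXu)
      (hη hΔ' hY)]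
    exact ThetaOrbitData.eqUpToRootOfUnity_refl _ _ _ _

/-! ## §2. The SECTION-route cover: `ι(Π^tp_{X̲}) = T.tp T.PiXu` discharged, `β` = the Thm 1.6 (ii) companion of `α` -/

end ThetaSetting.EtaleThetaData.DoubleUnderline.OrbitEmbedding

namespace MuTwoSetting.CLevelData

variable {p : ℕ} [Fact p.Prime] {M : MuTwoSetting p}
variable {PC : Type} [Group PC] [TopologicalSpace PC] [IsTopologicalGroup PC] [T2Space PC]

variable (e : M.CLevelData) (ιC : M.GtpC →ₜ* PC) (hιC : IsProfiniteCompletion ιC)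
  (hinj : Function.Injective ιC) (op : M.toThetaSetting.OncePuncturedData) {l : ℕ} (hodd : Odd l)
  (s : ↥M.GK →* M.PiTemp) (hsa : ∀ σ, M.aug (s σ) = (σ : GQp p)) (hsZ : ∀ σ, M.toZ (s σ) = 1)
  (hιell : ∀ c ∈ (e.piCDataOf ιC hιC).augGK.ker, c ∉ (e.piCDataOf ιC hιC).PiX →
    ∀ d ∈ (e.piCDataOf ιC hιC).PiX ⊓ (e.piCDataOf ιC hιC).augGK.ker,
      c * d * c⁻¹ * d ∈ (e.piCDataOf ιC hιC).barTheta l)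
  (hN : ((M.GtpXu l).map M.inclX).Normal) (hY : (M.GtpY.map M.inclX).Normal)
  {E : M.toThetaSetting.EtaleThetaData} (C : E.DoubleUnderline l) (hK : M.barKerTp l ≤ C.Huu)
  (hsH : ∀ σ, s σ ∈ C.Huu) {g : M.GtpC} (hgX : g ∉ M.inclX.range) (hι : C.IotaStable (e.conjX g))
  (τ τ' : ThetaSetting.NonCuspidalPoint E.toKummerData)

/-- **[EtTh] Cor 2.8 (i) — `ThetaOrbitData.Cor28_i` IN HEAD FORM at the SECTION-route cover
`ofEmbedding (orbitEmbeddingOfHuuOfSection …)`** (abc-iut-L2-d3 / abc-iut-f-151 constructor; ANY `CLevelData`, completion,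
section, `g`, `X̲̲`, slots `τ, τ′`), modulo ONE displayed hypothesis `H` in print's currency: every topological automorphism
`Γ` of `Π^tp_C` inducing on `Δ_Θ`, permuting `Dtau` and stabilising `Π^tp_Ÿ`, `Π^tp_X` RESTRICTS to an `α ∈ Aut_top(Π^tp_X)`
(`ι ∘ α = Γ ∘ ι`, Prop 2.4) with `α(Δ^tp_X) = Δ^tp_X` ([AbsAnab] Lem 1.3.8) and satisfies UNIT-FREE theta rigidity
`autMap α⁻¹ β⁻¹ η̈^Θ = σ₀·η̈^Θ` for the Thm 1.6 (ii) companion `β = topCompanion α` (abc-iut-L6-d5), `σ₀` located in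
`Π^tp_{X̲̲}` (resp. `Π^tp_{X̲}`) when `Γ` stabilises it.  `ι(Π^tp_{X̲}) = T.tp T.PiXu` is abc-iut-f-151's
`orbitEmbeddingOfHuuOfSection_map_GtpXu`; `IsQuotientMap toTheta` displayed.  HONEST LABEL: CONDITIONAL INSTANCE at a
semi-synthetic cover; `H` displayed, not proved. [cite: MochizukiEtTh2009, Cor 2.8(i) p.42] -/
theorem cor28_i_orbitEmbeddingOfHuuOfSection_of_forall_restricts (hq : IsQuotientMap M.toTheta)
    (hC : M.toThetaSetting.Compat) (hS : M.toThetaSetting.Sec2Hyps)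
    (H : ∀ (Γ : (e.temperedCoverDataOfHuuOfSection ιC hιC hinj op hodd s hsa hsZ hιell hN hY C hK hsH hgX hι).Gtp ≃ₜ*
          (e.temperedCoverDataOfHuuOfSection ιC hιC hinj op hodd s hsa hsZ hιell hN hY C hK hsH hgX hι).Gtp)
        (ΓΘ : (ThetaOrbitData.ofEmbedding
            (e.orbitEmbeddingOfHuuOfSection ιC hιC hinj op hodd s hsa hsZ hιell hN hY C hK hsH hgX hι τ τ') hC hS).DeltaTheta ≃*
          (ThetaOrbitData.ofEmbedding
            (e.orbitEmbeddingOfHuuOfSection ιC hιC hinj op hodd s hsa hsZ hιell hN hY C hK hsH hgX hι τ τ') hC hS).DeltaTheta),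
        (ThetaOrbitData.ofEmbedding
            (e.orbitEmbeddingOfHuuOfSection ιC hιC hinj op hodd s hsa hsZ hιell hN hY C hK hsH hgX hι τ τ') hC hS).InducesOnTheta
          Γ ΓΘ →
        (∀ Dt ∈ (ThetaOrbitData.ofEmbedding
            (e.orbitEmbeddingOfHuuOfSection ιC hιC hinj op hodd s hsa hsZ hιell hN hY C hK hsH hgX hι τ τ') hC hS).Dtau,
          Dt.map Γ.toMulEquiv.toMonoidHom ∈ (ThetaOrbitData.ofEmbedding
            (e.orbitEmbeddingOfHuuOfSection ιC hιC hinj op hodd s hsa hsZ hιell hN hY C hK hsH hgX hι τ τ') hC hS).Dtau) →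
        (e.temperedCoverDataOfHuuOfSection ιC hιC hinj op hodd s hsa hsZ hιell hN hY C hK hsH hgX hι).PiYddtp.map
            Γ.toMulEquiv.toMonoidHom =
          (e.temperedCoverDataOfHuuOfSection ιC hιC hinj op hodd s hsa hsZ hιell hN hY C hK hsH hgX hι).PiYddtp →
        ((e.temperedCoverDataOfHuuOfSection ιC hιC hinj op hodd s hsa hsZ hιell hN hY C hK hsH hgX hι).tp
              (e.temperedCoverDataOfHuuOfSection ιC hιC hinj op hodd s hsa hsZ hιell hN hY C hK hsH hgX hι).PiX).map
            Γ.toMulEquiv.toMonoidHom =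
          (e.temperedCoverDataOfHuuOfSection ιC hιC hinj op hodd s hsa hsZ hιell hN hY C hK hsH hgX hι).tp
            (e.temperedCoverDataOfHuuOfSection ιC hιC hinj op hodd s hsa hsZ hιell hN hY C hK hsH hgX hι).PiX →
        ∃ (α : M.PiTemp ≃ₜ* M.PiTemp)
          (hΔα : M.toThetaSetting.DeltaTemp.map α.toMulEquiv.toMonoidHom = M.toThetaSetting.DeltaTemp),
          (∀ σ, (e.orbitEmbeddingOfHuuOfSection ιC hιC hinj op hodd s hsa hsZ hιell hN hY C hK hsH hgX hι τ τ').ι (α σ) =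
            Γ ((e.orbitEmbeddingOfHuuOfSection ιC hιC hinj op hodd s hsa hsZ hιell hN hY C hK hsH hgX hι τ τ').ι σ)) ∧
          ∃ σ₀ : M.PiTemp,
            (((e.temperedCoverDataOfHuuOfSection ιC hιC hinj op hodd s hsa hsZ hιell hN hY C hK hsH hgX hι).tp
                  (e.temperedCoverDataOfHuuOfSection ιC hιC hinj op hodd s hsa hsZ hιell hN hY C hK hsH hgX hι).PiXuu).map
                Γ.toMulEquiv.toMonoidHom =
              (e.temperedCoverDataOfHuuOfSection ιC hιC hinj op hodd s hsa hsZ hιell hN hY C hK hsH hgX hι).tp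
                (e.temperedCoverDataOfHuuOfSection ιC hιC hinj op hodd s hsa hsZ hιell hN hY C hK hsH hgX hι).PiXuu →
              σ₀ ∈ C.Huu) ∧
            (((e.temperedCoverDataOfHuuOfSection ιC hιC hinj op hodd s hsa hsZ hιell hN hY C hK hsH hgX hι).tp
                  (e.temperedCoverDataOfHuuOfSection ιC hιC hinj op hodd s hsa hsZ hιell hN hY C hK hsH hgX hι).PiXu).map
                Γ.toMulEquiv.toMonoidHom =
              (e.temperedCoverDataOfHuuOfSection ιC hιC hinj op hodd s hsa hsZ hιell hN hY C hK hsH hgX hι).tp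
                (e.temperedCoverDataOfHuuOfSection ιC hιC hinj op hodd s hsa hsZ hιell hN hY C hK hsH hgX hι).PiXu →
              σ₀ ∈ M.toThetaSetting.GtpXu l) ∧
            ∀ (hΔ' : ∀ a, a ∈ M.toThetaSetting.DeltaTheta →
                (Thm16Sub.topCompanion M.toThetaSetting M.toThetaSetting α hΔα hq hq).symm a ∈ M.toThetaSetting.DeltaTheta)
              (hYα : ∀ g, g ∈ M.toThetaSetting.GtpYdd → α g ∈ M.toThetaSetting.GtpYdd),
              haveI := hC.GtpYdd_normal
              ContH1Aut.autMap M.toTheta M.toThetaSetting.DeltaTheta α.symm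
                  (Thm16Sub.topCompanion M.toThetaSetting M.toThetaSetting α hΔα hq hq).symm
                  (symm_toTheta_eq (fun σ =>
                    Thm16Sub.algCompanion_apply_toTheta M.toThetaSetting M.toThetaSetting α hΔα σ)) hΔ'
                  (H := M.toThetaSetting.GtpYdd) (H' := M.toThetaSetting.GtpYdd) hYα E.etaDd =
                ContH1.conj M.toTheta M.toThetaSetting.DeltaTheta σ₀ E.etaDd) :
    (ThetaOrbitData.ofEmbedding
        (e.orbitEmbeddingOfHuuOfSection ιC hιC hinj op hodd s hsa hsZ hιell hN hY C hK hsH hgX hι τ τ') hC hS).Cor28_i :=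
  (e.orbitEmbeddingOfHuuOfSection ιC hιC hinj op hodd s hsa hsZ hιell hN hY C hK hsH hgX hι τ τ').ofEmbedding_cor28_i_of_forall_comm
    hC hS (e.orbitEmbeddingOfHuuOfSection_map_GtpXu ιC hιC hinj op hodd s hsa hsZ hιell hN hY C hK hsH hgX hι τ τ')
    fun Γ ΓΘ hind hDtau hYmap hX => by
      obtain ⟨α, hΔα, hα, σ₀, h₁, h₂, hη⟩ := H Γ ΓΘ hind hDtau hYmap hX
      exact ⟨α, Thm16Sub.topCompanion M.toThetaSetting M.toThetaSetting α hΔα hq hq,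
        fun σ => Thm16Sub.algCompanion_apply_toTheta M.toThetaSetting M.toThetaSetting α hΔα σ, hα, σ₀, h₁, h₂, hη⟩

/-! ### §2′. The same head with `H` in PRINT's shape: «every topological automorphism `α` of `Π^tp_X` that EXTENDS …» -/

/-- **[EtTh] Cor 2.8 (i) — `ThetaOrbitData.Cor28_i` IN HEAD FORM at the SECTION-route cover, hypothesis in PRINT's shape**:
the head holds as soon as EVERY topological automorphism `α` of `Π^tp_X` that EXTENDS (`ι ∘ α = Γ ∘ ι`) to a topological
automorphism `Γ` of `Π^tp_C` inducing on `Δ_Θ`, permuting `Dtau` and stabilising `Π^tp_Ÿ` — print's «γ … of `Π^tp_{X̲̲}` (resp.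
`X̲`; `C̲̲`; `C̲`) … [extended by] Proposition 2.4» — preserves `Δ^tp_X` ([AbsAnab] Lem 1.3.8) and satisfies located UNIT-FREE
theta rigidity for its Thm 1.6 (ii) companion `topCompanion α` (Thm 1.10 (i) with unit `1` — STRONGER than print's
unit-carrying Thm 1.6 (iii)).  Reduction to §2: a `Γ`
stabilising `Π^tp_X = inclX(Π^tp_X)` (abc-iut-L2-d3 lineage's `temperedCoverDataOfHuuOfSection_tp_PiX`, `Sec2CuspStabSectionDatum`) RESTRICTS to a topological automorphism of
`Π^tp_X` because `inclX` is an open embedding (abc-iut-L2-d3's `CLevelData.isOpenEmbedding_inclX`, `continuous_ofInjective_symm`;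
the construction of `conjX` beyond inner automorphisms).  HONEST LABEL: CONDITIONAL instance; `H` displayed, not proved.
[cite: MochizukiEtTh2009, Cor 2.8(i) p.42] -/
theorem cor28_i_orbitEmbeddingOfHuuOfSection_of_forall_extends (hq : IsQuotientMap M.toTheta)
    (hC : M.toThetaSetting.Compat) (hS : M.toThetaSetting.Sec2Hyps)
    (H : ∀ (Γ : (e.temperedCoverDataOfHuuOfSection ιC hιC hinj op hodd s hsa hsZ hιell hN hY C hK hsH hgX hι).Gtp ≃ₜ*
          (e.temperedCoverDataOfHuuOfSection ιC hιC hinj op hodd s hsa hsZ hιell hN hY C hK hsH hgX hι).Gtp)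
        (ΓΘ : (ThetaOrbitData.ofEmbedding
            (e.orbitEmbeddingOfHuuOfSection ιC hιC hinj op hodd s hsa hsZ hιell hN hY C hK hsH hgX hι τ τ') hC hS).DeltaTheta ≃*
          (ThetaOrbitData.ofEmbedding
            (e.orbitEmbeddingOfHuuOfSection ιC hιC hinj op hodd s hsa hsZ hιell hN hY C hK hsH hgX hι τ τ') hC hS).DeltaTheta),
        (ThetaOrbitData.ofEmbedding
            (e.orbitEmbeddingOfHuuOfSection ιC hιC hinj op hodd s hsa hsZ hιell hN hY C hK hsH hgX hι τ τ') hC hS).InducesOnTheta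
          Γ ΓΘ →
        (∀ Dt ∈ (ThetaOrbitData.ofEmbedding
            (e.orbitEmbeddingOfHuuOfSection ιC hιC hinj op hodd s hsa hsZ hιell hN hY C hK hsH hgX hι τ τ') hC hS).Dtau,
          Dt.map Γ.toMulEquiv.toMonoidHom ∈ (ThetaOrbitData.ofEmbedding
            (e.orbitEmbeddingOfHuuOfSection ιC hιC hinj op hodd s hsa hsZ hιell hN hY C hK hsH hgX hι τ τ') hC hS).Dtau) →
        (e.temperedCoverDataOfHuuOfSection ιC hιC hinj op hodd s hsa hsZ hιell hN hY C hK hsH hgX hι).PiYddtp.map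
            Γ.toMulEquiv.toMonoidHom =
          (e.temperedCoverDataOfHuuOfSection ιC hιC hinj op hodd s hsa hsZ hιell hN hY C hK hsH hgX hι).PiYddtp →
        ∀ (α : M.PiTemp ≃ₜ* M.PiTemp), (∀ σ, M.inclX (α σ) = Γ (M.inclX σ)) →
        ∃ (hΔα : M.toThetaSetting.DeltaTemp.map α.toMulEquiv.toMonoidHom = M.toThetaSetting.DeltaTemp)
          (σ₀ : M.PiTemp),
            (((e.temperedCoverDataOfHuuOfSection ιC hιC hinj op hodd s hsa hsZ hιell hN hY C hK hsH hgX hι).tp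
                  (e.temperedCoverDataOfHuuOfSection ιC hιC hinj op hodd s hsa hsZ hιell hN hY C hK hsH hgX hι).PiXuu).map
                Γ.toMulEquiv.toMonoidHom =
              (e.temperedCoverDataOfHuuOfSection ιC hιC hinj op hodd s hsa hsZ hιell hN hY C hK hsH hgX hι).tp
                (e.temperedCoverDataOfHuuOfSection ιC hιC hinj op hodd s hsa hsZ hιell hN hY C hK hsH hgX hι).PiXuu →
              σ₀ ∈ C.Huu) ∧
            (((e.temperedCoverDataOfHuuOfSection ιC hιC hinj op hodd s hsa hsZ hιell hN hY C hK hsH hgX hι).tp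
                  (e.temperedCoverDataOfHuuOfSection ιC hιC hinj op hodd s hsa hsZ hιell hN hY C hK hsH hgX hι).PiXu).map
                Γ.toMulEquiv.toMonoidHom =
              (e.temperedCoverDataOfHuuOfSection ιC hιC hinj op hodd s hsa hsZ hιell hN hY C hK hsH hgX hι).tp
                (e.temperedCoverDataOfHuuOfSection ιC hιC hinj op hodd s hsa hsZ hιell hN hY C hK hsH hgX hι).PiXu →
              σ₀ ∈ M.toThetaSetting.GtpXu l) ∧
            ∀ (hΔ' : ∀ a, a ∈ M.toThetaSetting.DeltaTheta →
                (Thm16Sub.topCompanion M.toThetaSetting M.toThetaSetting α hΔα hq hq).symm a ∈ M.toThetaSetting.DeltaTheta)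
              (hYα : ∀ g, g ∈ M.toThetaSetting.GtpYdd → α g ∈ M.toThetaSetting.GtpYdd),
              haveI := hC.GtpYdd_normal
              ContH1Aut.autMap M.toTheta M.toThetaSetting.DeltaTheta α.symm
                  (Thm16Sub.topCompanion M.toThetaSetting M.toThetaSetting α hΔα hq hq).symm
                  (symm_toTheta_eq (fun σ =>
                    Thm16Sub.algCompanion_apply_toTheta M.toThetaSetting M.toThetaSetting α hΔα σ)) hΔ'
                  (H := M.toThetaSetting.GtpYdd) (H' := M.toThetaSetting.GtpYdd) hYα E.etaDd =
                ContH1.conj M.toTheta M.toThetaSetting.DeltaTheta σ₀ E.etaDd) :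
    (ThetaOrbitData.ofEmbedding
        (e.orbitEmbeddingOfHuuOfSection ιC hιC hinj op hodd s hsa hsZ hιell hN hY C hK hsH hgX hι τ τ') hC hS).Cor28_i := by
  refine e.cor28_i_orbitEmbeddingOfHuuOfSection_of_forall_restricts ιC hιC hinj op hodd s hsa hsZ hιell hN hY C hK hsH
    hgX hι τ τ' hq hC hS fun Γ ΓΘ hind hDtau hYmap hX => ?_
  -- `Γ` stabilises `inclX(Π^tp_X)`, in both directions
  rw [e.temperedCoverDataOfHuuOfSection_tp_PiX ιC hιC hinj op hodd s hsa hsZ hιell hN hY C hK hsH hgX hι] at hX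
  have hmem : ∀ x : M.PiTemp, Γ (M.inclX x) ∈ M.inclX.range := fun x => hX.le ⟨M.inclX x, ⟨x, rfl⟩, rfl⟩
  have hmem' : ∀ x : M.PiTemp, Γ.symm (M.inclX x) ∈ M.inclX.range := fun x => by
    obtain ⟨y, ⟨z, rfl⟩, hyz⟩ := hX.ge (⟨x, rfl⟩ : M.inclX x ∈ M.inclX.range)
    refine ⟨z, ?_⟩
    rw [← hyz]
    exact (Γ.symm_apply_apply _).symm
  -- the restriction `α` of `Γ` to `Π^tp_X` (continuous: `inclX` is an open embedding)
  have hf : ∀ x, M.inclX ((MonoidHom.ofInjective M.injective_inclX).symm ⟨Γ (M.inclX x), hmem x⟩) = Γ (M.inclX x) :=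
    fun x => MonoidHom.apply_ofInjective_symm M.injective_inclX _
  have hg : ∀ x, M.inclX ((MonoidHom.ofInjective M.injective_inclX).symm ⟨Γ.symm (M.inclX x), hmem' x⟩) =
      Γ.symm (M.inclX x) :=
    fun x => MonoidHom.apply_ofInjective_symm M.injective_inclX _
  have hΓmul : ∀ a b : M.GtpC, Γ (a * b) = Γ a * Γ b := fun a b => map_mul Γ a b
  let α : M.PiTemp ≃ₜ* M.PiTemp :=
    { toFun := fun x => (MonoidHom.ofInjective M.injective_inclX).symm ⟨Γ (M.inclX x), hmem x⟩
      invFun := fun x => (MonoidHom.ofInjective M.injective_inclX).symm ⟨Γ.symm (M.inclX x), hmem' x⟩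
      left_inv := fun x => M.injective_inclX (by rw [hg, hf, ContinuousMulEquiv.symm_apply_apply])
      right_inv := fun x => M.injective_inclX (by rw [hf, hg, ContinuousMulEquiv.apply_symm_apply])
      map_mul' := fun x y => M.injective_inclX (by rw [hf, map_mul, map_mul, hΓmul, hf, hf]; rfl)
      continuous_toFun := e.continuous_ofInjective_symm.comp
        (Continuous.subtype_mk (Γ.continuous.comp M.continuous_inclX) _)
      continuous_invFun := e.continuous_ofInjective_symm.comp
        (Continuous.subtype_mk (Γ.symm.continuous.comp M.continuous_inclX) _) }
  have hα : ∀ σ, M.inclX (α σ) = Γ (M.inclX σ) := hf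
  obtain ⟨hΔα, σ₀, h₁, h₂, hη⟩ := H Γ ΓΘ hind hDtau hYmap α hα
  exact ⟨α, hΔα, hα, σ₀, h₁, h₂, hη⟩

end MuTwoSetting.CLevelData

end Literature.AnabelianGeometry.EtaleTheta

end
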